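import Summits.BirchSwinnertonDyer.BirchSwinnertonDyer.Theses.EdixhovenFibreFiveSeven
import Summits.BirchSwinnertonDyer.BirchSwinnertonDyer.Theorems.AdditiveKolyvaginRoadIstarIsogenyInvariance
import Summits.BirchSwinnertonDyer.Rank1Residual.Additive.GordKodairaType
import Summits.BirchSwinnertonDyer.Rank1Residual.Additive.GordIsogenyInvarianceClasses
import Summits.BirchSwinnertonDyer.Rank1Residual.AdditivePotMult.PStarTwistModel
import Literature.NumberTheory.EllipticCurves.NeronLocalHeightCompletion
import Literature.NumberTheory.EllipticCurves.IsogenyIdProofs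
import HarnessLib

/-!
# Route `EdixhovenFibreFiveSeven`, support item `MemberManinUnitFiveSevenGlue` (G57,
# stmt-BirchSwinnertonDyer-22229): the typed glue obligation, PROVED

Cell `pub/bsd-wall` (D-0145 line `route-BirchSwinnertonDyer-EdixhovenFibreFiveSeven`), seat
`bsd-line-edix-p2` (prover). THEOREMS ONLY (no definition, no named fact, no `sorry`). BSD is not
proved by this file; the two cruxes K★ (`StarredOptimalManinUnitFiveSeven`, stmt-22226) and TDS57
(`TwistDegreeStepFiveSeven`, stmt-22227) enter as HYPOTHESES of the item, exactly as filed.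

The item is the `p < 11` port of p540328
`ManinFrameResidueProperTwistDegree.exists_member_not_dvd_c_of_twistDegreeStep`: granted modularity
(`exists_isNewformOf`), Dokchitser–Dokchitser 2015 Thm. 5.1 (1) (class invariance of `ord_p Δ_min`
under a prime-to-`p` isogeny on the potentially good locus), K★ and TDS57, every AKR pair `(W, p)`
with `5 ≤ p < 11` (so `p ∈ {5, 7}`), `W` additive at `p`, `E[p]` irreducible and some globally
minimal member of the class without `Iₙ*` fibre at `p`, has a globally minimal member `W₀ ∼ W`
carrying a conductor-level parametrisation datum with `p ∤ c`.

* §1 `padicValRat_j_nonneg_of_forall_ne_Istar` — at an odd additive prime, "no `Iₙ*` fibre at the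
  place under `p`" forces potentially good reduction `0 ≤ ord_p j` (a potentially multiplicative
  additive curve is the `p*`-twist of a multiplicative one, `PotMult.exists_mult_pStar_twist_model`,
  hence of type `Iₙ*`, `kodairaSymbolAt_twist_of_semistable`); and the converse direction used for
  the twist, `forall_ne_Istar_of_padicValRat_j_nonneg` — at an additive `p ≥ 5`, `0 ≤ ord_p j` and
  `ord_p Δ_min ≠ 6` exclude every `Iₙ*` (`I₀*` has `ord_p Δ_min = 6`, `Iₙ*` with `n ≥ 1` has
  `ord_p j < 0`; Tate's algorithm, tree `GordKodairaType` / `TateAlgorithmTameTypesOddProofs`).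
* §2 `forall_ne_Istar_of_isIsogenous` — "no `Iₙ*` fibre at `p`" moves along the `ℚ`-isogeny class
  (`IstarIsogenyInvariance.exists_kodairaSymbolAt_eq_Istar_of_isIsogenous`).
* §3 STARRED side `exists_member_not_dvd_c_of_four_lt` — `4 < ord_p Δ_min(W)`: K★ at the
  `X₀(N)`-optimal member `W₀ ∼ W` (`X12.exists_isIsogenous_optimal`; additivity, irreducibility and
  "no `Iₙ*`" are class invariants, `4 < ord_p Δ_min` transports by Dokchitser–Dokchitser along a
  cyclic isogeny, prime to `p` under `Irr`); `W₀` itself is the member.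
* §4 UNSTARRED side `exists_member_not_dvd_c_of_le_four` — `ord_p Δ_min(W) ≤ 4`: the globally
  minimal `p*`-twist `W♭` (`exists_minimal_twist_pStar`) is additive, potentially good, with
  `ord_p Δ_min(W♭) = ord_p Δ_min(W) + 6 ∈ {8, 9, 10}`, so without `Iₙ*` fibre (§1) and with `E♭[p]`
  irreducible; K★ at the optimal member of ITS class and prime-to-`p` transport
  (`ManinFrameTransport.exists_modularParametrizationData_not_dvd_of_partner`) give a conductor-level
  datum `D♭` of `W♭` with `p ∤ c(D♭)`; TDS57 gives a datum `D` of `W` with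
  `v_p(deg D) < v_p(deg D♭)`; the cell's `p`-adic twist identity
  `v_p(deg D♭) + 2 v_p(c(D)) = v_p(deg D) + 2 v_p(c(D♭)) + 1` (`Additive.padicVal_twist_identity`,
  `5 ≤ p`) then forces `p ∤ c(D)`; `W` itself is the member.
* §5 `memberManinUnitFiveSevenGlue_proof` — the item BY NAME: the `Iₙ*`-member of the residue clause
  moves "no `Iₙ*`" to `W` (§2); split on `ord_p Δ_min(W) ≤ 4`.

References: [EdixhovenManin1991] Progr. Math. 89 (1991), Thm. 3 and §4 (author's typescript
L1019–1167: the twist comparison); [DokchitserDokchitser2015LocalInvariants] Trans. AMS 367 (2015)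
Thm. 5.1 (1); [ZagierCMB1985] §1; [SilvermanATAEC1994] IV.9.4 Steps 6–7 and Table 4.1;
[SilvermanAEC2009] VII.5 Prop. 5.1, X.5 Cor. 5.4.
-/

set_option autoImplicit false
-- the Theorems directory repeats the summit name (sibling precedent `SignedBaseChangeAssembly.lean`)
set_option linter.dupNamespace false

noncomputable section

open scoped Classical NumberField

open WeierstrassCurve NumberField Literature.NumberTheory.EllipticCurves
  Literature.NumberTheory.EllipticCurves.ModularForms
  Literature.NumberTheory.EllipticCurves.Rank1Residual
  Literature.NumberTheory.DiophantineGeometry IsDedekindDomain Rat.HeightOneSpectrum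
  Summit.BirchSwinnertonDyer.Rank1Residual Summit.BirchSwinnertonDyer.Rank1Residual.Additive
  Summit.BirchSwinnertonDyer.BirchSwinnertonDyer.Theorems

namespace Summit.BirchSwinnertonDyer.BirchSwinnertonDyer.Theorems.MemberManinUnitFiveSevenGlue

/-! ### §0 Bookkeeping -/

/-- A datum with `p ∤ c` at level `N` is one at any level `M = N`. [folklore] -/
private theorem exists_datum_not_dvd_of_level_eq {W : WeierstrassCurve ℚ} {N M : ℕ} [NeZero N]
    [NeZero M] (h : N = M) {p : ℕ} (D : ModularParametrizationData W N) (hc : ¬ (p : ℤ) ∣ D.c) :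
    ∃ D' : ModularParametrizationData W M, ¬ (p : ℤ) ∣ D'.c := by
  subst h
  exact ⟨D, hc⟩

/-! ### §1 "No `Iₙ*` fibre at `p`" versus `0 ≤ ord_p j` at an additive prime -/

section Istar

variable {p : ℕ} [hp : Fact p.Prime]

/-- The generator of the place of `ℤ` under `p` is `p`. [folklore] -/
private theorem natGenerator_placeOf : natGenerator (placeOf p) = p :=
  congrArg Subtype.val ((primesEquiv (R := ℤ)).apply_symm_apply ⟨p, hp.out⟩)

/-- A place of `ℤ` with generator `p` IS the place under `p`. [folklore] -/
private theorem eq_placeOf_of_natGenerator_eq {v : HeightOneSpectrum ℤ} (hv : natGenerator v = p) :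
    v = placeOf p := by
  apply (primesEquiv (R := ℤ)).injective
  exact Subtype.ext (hv.trans (natGenerator_placeOf (p := p)).symm)

/-- **No `Iₙ*` fibre at an odd additive prime ⟹ potentially good (`0 ≤ ord_p j`).** If
`ord_p j < 0` then the additive `W` is the `p*`-twist of a globally minimal curve `V` multiplicative
at `p` (`AdditivePotMult.PotMult.exists_mult_pStar_twist_model`), so Tate's algorithm Steps 6–7
(`kodairaSymbolAt_twist_of_semistable`, twist by a parameter exactly divisible by `p`) give `W` the
Kodaira type `Iₙ*` at the place under `p` — excluded by hypothesis.
[cite: SilvermanATAEC1994, IV.9.4 Steps 6–7 (PDF pp. 345–346) and Table 4.1] -/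
theorem padicValRat_j_nonneg_of_forall_ne_Istar (W : WeierstrassCurve ℚ) [W.IsElliptic]
    [W.IsGloballyMinimal] (hp2 : p ≠ 2) (hadd : Addv W p)
    (hK : ∀ (v : HeightOneSpectrum ℤ) (n : ℕ), natGenerator v = p →
      W.kodairaSymbolAt v ≠ KodairaSymbol.Istar n) :
    0 ≤ padicValRat p W.j := by
  by_contra hj
  push Not at hj
  obtain ⟨V, iV, iVm, C, hmV, hW⟩ :=
    AdditivePotMult.PotMult.exists_mult_pStar_twist_model (W := W) (p := p) ⟨hadd, hj⟩ hp2
  set u : HeightOneSpectrum (𝓞 ℚ) := (primesEquiv (R := 𝓞 ℚ)).symm ⟨p, hp.out⟩ with hudef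
  have hu : (primesEquiv u : ℕ) = p := by rw [hudef, Equiv.apply_symm_apply]
  have hu2 : (primesEquiv u : ℕ) ≠ 2 := by rw [hu]; exact hp2
  -- `V` is multiplicative at the place `u`
  have hmult : V.HasMultiplicativeReductionAt u := by
    have key := V.hasMultiplicativeReductionAtPrime_iff_hasMultiplicativeReductionAt_ringOfIntegers u
    revert key
    generalize primesEquiv u = q at hu ⊢
    obtain ⟨q, hq⟩ := q
    cases hu
    intro key
    exact key.mp hmV
  -- `p*` as an integer, exactly divisible by `p`
  obtain ⟨hD0, h1, h2⟩ := IstarIsogenyInvariance.pStar_dvd_facts hp.out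
  have hW' : C • V.quadraticTwist ((((-1 : ℤ) ^ (p / 2) * p : ℤ)) : ℚ) = W := by
    rw [(pStar_intCast p).1]; exact hW
  obtain ⟨n, hn⟩ := kodairaSymbolAt_twist_of_semistable u V hu2 (D := (-1 : ℤ) ^ (p / 2) * p) hD0
    (by rw [hu]; exact h1) (by rw [hu]; exact h2) (Or.inr hmult) C hW'
  -- read at the place of `ℤ` under `p`
  have hvu : primesEquiv (placeOf p) = primesEquiv u := by
    rw [hudef, Equiv.apply_symm_apply]; exact (primesEquiv (R := ℤ)).apply_symm_apply ⟨p, hp.out⟩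
  have hK' : W.kodairaSymbolAt (placeOf p) = .Istar n := by
    rw [O5.FlexNormalForm.kodairaSymbolAt_eq_of_primesEquiv_eq' W (placeOf p) u hvu]; exact hn
  exact hK (placeOf p) n natGenerator_placeOf hK'

/-- **Potentially good, additive at `p ≥ 5`, `ord_p Δ_min ≠ 6` ⟹ no `Iₙ*` fibre at `p`.** At an
additive `p ≥ 5`, `ord_p Δ_min = m_p + 1` (Ogg, `f_p = 2`), so `I₀*` means `ord_p Δ_min = 6`; and
`Iₙ*` with `n ≥ 1` means `ord_p j < 0` (Tate's algorithm Step 7: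
`one_lt_valuation_j_of_kodairaSymbolAt_eq_Istar_succ`). [cite: SilvermanATAEC1994, IV.9.4 Step 7 and Table 4.1 (PDF p. 365)] -/
theorem forall_ne_Istar_of_padicValRat_j_nonneg (W : WeierstrassCurve ℚ) [W.IsElliptic]
    [W.IsGloballyMinimal] (hp5 : 5 ≤ p) (hadd : Addv W p) (hj : 0 ≤ padicValRat p W.j)
    (h6 : padicValInt p W.minimalDiscriminantInt ≠ 6) :
    ∀ (v : HeightOneSpectrum ℤ) (n : ℕ), natGenerator v = p →
      W.kodairaSymbolAt v ≠ KodairaSymbol.Istar n := by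
  intro v n hv hK
  have hvv : v = placeOf p := eq_placeOf_of_natGenerator_eq hv
  subst hvv
  cases n with
  | zero =>
    have h := padicValInt_minimalDiscriminantInt_eq_numComponents_add_one W p hp5 hadd
    rw [hK, KodairaSymbol.numComponents_Istar] at h
    exact h6 (by omega)
  | succ k =>
    haveI : PerfectField (IsLocalRing.ResidueField ((placeOf p).adicCompletionIntegers ℚ)) :=
      PerfectField.ofFinite
    have hchar : ringChar (ℤ ⧸ (placeOf p).asIdeal) ≠ 2 := by
      rw [ringChar_int_quot_placeOf p]; omega
    have h1 := one_lt_valuation_j_of_kodairaSymbolAt_eq_Istar_succ (placeOf p) W hchar hK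
    have hj0 : W.j ≠ 0 := by
      intro h0
      rw [h0, map_zero] at h1
      exact not_lt.mpr zero_le_one h1
    rw [Rat.HeightOneSpectrum.valuation_eq_exp_neg_padicValRat (placeOf p) hj0,
      natGenerator_placeOf, ← WithZero.exp_zero, WithZero.exp_lt_exp] at h1
    linarith

/-- `ord_p Δ_min ≥ 2` at an additive `p ≥ 5` (the additive Kodaira types have `m_p ≥ 1`).
[cite: SilvermanATAEC1994, IV Table 4.1 (PDF p. 365)] -/
theorem two_le_padicValInt_minimalDiscriminantInt_of_addv (W : WeierstrassCurve ℚ) [W.IsElliptic]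
    [W.IsGloballyMinimal] (hp5 : 5 ≤ p) (hadd : Addv W p) :
    2 ≤ padicValInt p W.minimalDiscriminantInt := by
  rcases kodairaSymbolAt_placeOf_cases_of_addv W p hp5 hadd with
    ⟨-, hv⟩ | ⟨-, hv⟩ | ⟨-, hv⟩ | ⟨n, -, hv⟩ | ⟨-, hv⟩ | ⟨-, hv⟩ | ⟨-, hv⟩ <;> omega

end Istar

/-! ### §2 "No `Iₙ*` fibre at `p`" along the isogeny class -/

/-- **"No `Iₙ*` fibre at the place under the odd prime `p`" is a `ℚ`-isogeny invariant** (the type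
`Iₙ*` of a member would transport back, `IstarIsogenyInvariance.exists_kodairaSymbolAt_eq_Istar_of_isIsogenous`).
[cite: SilvermanATAEC1994, IV.9.4 Steps 6–7 (PDF pp. 345–346)] -/
theorem forall_ne_Istar_of_isIsogenous {W W' : WeierstrassCurve ℚ} [W.IsElliptic] [W'.IsElliptic]
    (h : IsIsogenous W W') {p : ℕ} (hp2 : p ≠ 2)
    (hK : ∀ (v : HeightOneSpectrum ℤ) (n : ℕ), natGenerator v = p →
      W.kodairaSymbolAt v ≠ KodairaSymbol.Istar n) :
    ∀ (v : HeightOneSpectrum ℤ) (n : ℕ), natGenerator v = p →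
      W'.kodairaSymbolAt v ≠ KodairaSymbol.Istar n := by
  intro v n hv hK'
  obtain ⟨m, hm⟩ :=
    IstarIsogenyInvariance.exists_kodairaSymbolAt_eq_Istar_of_isIsogenous h.symm_of_charZero hp2 v hv
      hK'
  exact hK v m hv hm

/-! ### §3 The STARRED side: K★ at the optimal member -/

section Starred

variable {p : ℕ} [hp : Fact p.Prime]

open Summit.BirchSwinnertonDyer.BirchSwinnertonDyer.Theses.EdixhovenFibreFiveSeven in
/-- **Starred side.** `W/ℚ` globally minimal, `p ∈ {5, 7}` additive with `E[p]` irreducible, no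
`Iₙ*` fibre at `p` and `4 < ord_p Δ_min(W)` (Kodaira IV*, III*, II*). GRANTED modularity `hnf`,
Dokchitser–Dokchitser `hDD` and K★ `hS`: the `X₀(N)`-optimal member `W₀ ∼ W`
(`X12.exists_isIsogenous_optimal`, lattice-optimal datum `Λ_{E₀} = c₀ Λ_f`) is again additive with
`E₀[p]` irreducible and no `Iₙ*` fibre (class invariants), and `4 < ord_p Δ_min(W₀)` because a cyclic
isogeny `W → W₀` has degree prime to `p` under `Irr` and `W` is potentially good (§1); K★ gives
`p ∤ c₀`, at level `N(W₀) = N(W)`. [cite: DokchitserDokchitser2015LocalInvariants, Thm. 5.1 (1) and Table 1]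
[cite: EdixhovenManin1991, Thm. 3] -/
theorem exists_member_not_dvd_c_of_four_lt (hnf : exists_isNewformOf)
    (hDD : dokchitser_padicValInt_minimalDiscriminantInt_eq_of_isogeny_of_not_dvd_degree)
    (hS : StarredOptimalManinUnitFiveSeven)
    (W : WeierstrassCurve ℚ) [W.IsElliptic] [W.IsGloballyMinimal] [NeZero (W.conductorNorm ℤ)]
    (hp57 : p = 5 ∨ p = 7) (hadd : Addv W p) (hirr : Irr W p)
    (hK : ∀ (v : HeightOneSpectrum ℤ) (n : ℕ), natGenerator v = p →
      W.kodairaSymbolAt v ≠ KodairaSymbol.Istar n)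
    (hv : 4 < padicValInt p W.minimalDiscriminantInt) :
    ∃ (W₀ : WeierstrassCurve ℚ) (_ : W₀.IsElliptic) (_ : W₀.IsGloballyMinimal)
        (D₀ : ModularParametrizationData W₀ (W.conductorNorm ℤ)),
        IsIsogenous W W₀ ∧ ¬ (p : ℤ) ∣ D₀.c := by
  have hp2 : p ≠ 2 := by omega
  have hj : 0 ≤ padicValRat p W.j := padicValRat_j_nonneg_of_forall_ne_Istar W hp2 hadd hK
  obtain ⟨W₀, hE₀, hM₀, hNz₀, D₀, hiso, hN, hopt₀⟩ := X12.exists_isIsogenous_optimal hnf W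
  haveI := hE₀
  haveI := hM₀
  haveI := hNz₀
  have hadd₀ : Addv W₀ p := (X2.addv_iff_of_isIsogenous (p := p) hiso).mp hadd
  have hirr₀ : Irr W₀ p := (X12.irr_iff_of_isIsogenous hiso p).mp hirr
  have hK₀ := forall_ne_Istar_of_isIsogenous hiso hp2 hK
  have hv₀ : 4 < padicValInt p W₀.minimalDiscriminantInt := by
    obtain ⟨ψ, hψ⟩ := hiso.exists_isCyclic
    have hdeg : ¬ p ∣ ψ.degree := X11b.not_dvd_degree_of_isCyclic_of_irr ψ hψ hp.out hirr
    rw [← hDD W W₀ ψ p hp.out hdeg hj]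
    exact hv
  have hc₀ : ¬ (p : ℤ) ∣ D₀.c := hS W₀ p D₀ hp57 hadd₀ hirr₀ hK₀ hv₀ hopt₀
  obtain ⟨D', hc'⟩ := exists_datum_not_dvd_of_level_eq hN D₀ hc₀
  exact ⟨W₀, hE₀, hM₀, D', hiso, hc'⟩

end Starred

/-! ### §4 The UNSTARRED side: K★ at the optimal member of the twisted class, then TDS57 -/

section Unstarred

variable {p : ℕ} [hp : Fact p.Prime]

/-- **`v_p(deg D) < v_p(deg D♭)` and `p ∤ c(D♭)` force `p ∤ c(D)`** (`p ≥ 5`, `V` additive and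
potentially good with `ord_p Δ_min(V) < 6`, `W♭` a globally minimal model of `V ⊗ χ_{p*}`): the
cell's `p`-adic twist identity `v_p(deg D♭) + 2·v_p(c(D)) = v_p(deg D) + 2·v_p(c(D♭)) + 1`
(`Additive.padicVal_twist_identity`) read with `v_p(c(D♭)) = 0`.
[cite: ZagierCMB1985, §1 (p. 374)] [cite: Watkins2002, §2.1 (p. 491)] -/
theorem not_dvd_c_of_padicVal_modularDegree_lt' (hp5 : 5 ≤ p) (V Wf : WeierstrassCurve ℚ)
    [V.IsElliptic] [V.IsGloballyMinimal] [Wf.IsElliptic] [Wf.IsGloballyMinimal] (hV : Addv V p)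
    (hj : 0 ≤ padicValRat p V.j) (hV6 : padicValInt p V.minimalDiscriminantInt < 6)
    (C : VariableChange ℚ) (hC : C • V.quadraticTwist ((-1 : ℚ) ^ (p / 2) * p) = Wf)
    [NeZero (V.conductorNorm ℤ)] [NeZero (Wf.conductorNorm ℤ)]
    (D : ModularParametrizationData V (V.conductorNorm ℤ))
    (Df : ModularParametrizationData Wf (Wf.conductorNorm ℤ))
    (hlt : padicValNat p D.modularDegree < padicValNat p Df.modularDegree)
    (hcf : ¬ (p : ℤ) ∣ Df.c) : ¬ (p : ℤ) ∣ D.c := by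
  have h := padicVal_twist_identity p hp5 V Wf hV hj hV6 C hC D Df
  have hcf0 : padicValInt p Df.maninConstant = 0 := padicValInt.eq_zero_of_not_dvd hcf
  have hc0 : padicValInt p D.maninConstant = 0 := by omega
  intro hdvd
  have hne : D.maninConstant ≠ 0 := D.maninConstant_ne_zero_holds
  have h1 : 1 ≤ padicValInt p D.maninConstant := by
    have h' : (p : ℤ) ^ 1 ∣ D.maninConstant := by rw [pow_one]; exact hdvd
    rw [padicValInt_dvd_iff] at h'
    exact h'.resolve_left hne
  omega

open Summit.BirchSwinnertonDyer.BirchSwinnertonDyer.Theses.EdixhovenFibreFiveSeven in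
/-- **Unstarred side.** `W/ℚ` globally minimal, `p ∈ {5, 7}` additive with `E[p]` irreducible, no
`Iₙ*` fibre at `p` and `ord_p Δ_min(W) ≤ 4` (Kodaira II, III, IV). GRANTED `hnf`, `hDD`, K★ `hS`
and TDS57 `hT`: let `W♭` be a globally minimal model of `W ⊗ χ_{p*}` (`exists_minimal_twist_pStar`);
it is additive and potentially good with `ord_p Δ_min(W♭) = ord_p Δ_min(W) + 6 ∈ {8, 9, 10}`
(`addv_of_twist_pStar`, `padicValRat_u_eq_zero_and_padicValInt_eq_of_twist_pStar`), hence has no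
`Iₙ*` fibre (§1), and `E♭[p]` is irreducible
(`hasIrreducibleModPGaloisRep_of_smul_eq_quadraticTwist`). K★ at the optimal member of the class of
`W♭` (as in §3) and prime-to-`p` transport back to `W♭`
(`ManinFrameTransport.exists_modularParametrizationData_not_dvd_of_partner`) give a conductor-level
datum `D♭` of `W♭` with `p ∤ c(D♭)`; TDS57 gives a conductor-level datum `D` of `W` with
`v_p(deg D) < v_p(deg D♭)`; the twist identity forces `p ∤ c(D)`. The member is `W` itself.
[cite: EdixhovenManin1991, §4 (cases 1/2)] [cite: ZagierCMB1985, §1 (p. 374)]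
[cite: DokchitserDokchitser2015LocalInvariants, Thm. 5.1 (1)] [cite: SilvermanAEC2009, X.5 Cor. 5.4] -/
theorem exists_member_not_dvd_c_of_le_four (hnf : exists_isNewformOf)
    (hDD : dokchitser_padicValInt_minimalDiscriminantInt_eq_of_isogeny_of_not_dvd_degree)
    (hS : StarredOptimalManinUnitFiveSeven) (hT : TwistDegreeStepFiveSeven)
    (W : WeierstrassCurve ℚ) [W.IsElliptic] [W.IsGloballyMinimal] [NeZero (W.conductorNorm ℤ)]
    (hp57 : p = 5 ∨ p = 7) (hadd : Addv W p) (hirr : Irr W p)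
    (hK : ∀ (v : HeightOneSpectrum ℤ) (n : ℕ), natGenerator v = p →
      W.kodairaSymbolAt v ≠ KodairaSymbol.Istar n)
    (hv4 : padicValInt p W.minimalDiscriminantInt ≤ 4) :
    ∃ (W₀ : WeierstrassCurve ℚ) (_ : W₀.IsElliptic) (_ : W₀.IsGloballyMinimal)
        (D₀ : ModularParametrizationData W₀ (W.conductorNorm ℤ)),
        IsIsogenous W W₀ ∧ ¬ (p : ℤ) ∣ D₀.c := by
  have hp2 : p ≠ 2 := by omega
  have hp5 : 5 ≤ p := by omega
  have hj : 0 ≤ padicValRat p W.j := padicValRat_j_nonneg_of_forall_ne_Istar W hp2 hadd hK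
  have hW6 : padicValInt p W.minimalDiscriminantInt < 6 := by omega
  have hW2 := two_le_padicValInt_minimalDiscriminantInt_of_addv W hp5 hadd
  -- the globally minimal `p*`-twist `W♭`
  obtain ⟨Wf, hEf, hMf, C, hC⟩ := exists_minimal_twist_pStar p W
  haveI := hEf
  haveI := hMf
  haveI : NeZero (Wf.conductorNorm ℤ) := ⟨(Wf.conductorNorm_pos_holds).ne'⟩
  obtain ⟨haddf, hjf, -⟩ := addv_of_twist_pStar p hp2 W Wf hj hW6 C hC
  have hΔf : padicValInt p Wf.minimalDiscriminantInt = padicValInt p W.minimalDiscriminantInt + 6 :=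
    (padicValRat_u_eq_zero_and_padicValInt_eq_of_twist_pStar p hp2 W Wf hW6 C hC).2
  have hKf := forall_ne_Istar_of_padicValRat_j_nonneg Wf hp5 haddf hjf (by omega)
  have hd0 : ((-1 : ℚ) ^ (p / 2) * p) ≠ 0 :=
    mul_ne_zero (pow_ne_zero _ (by norm_num)) (by exact_mod_cast hp.out.ne_zero)
  have hC' : C⁻¹ • Wf = W.quadraticTwist ((-1 : ℚ) ^ (p / 2) * p) := by rw [← hC, inv_smul_smul]
  have hirrf : Irr Wf p :=
    BurungaleSkinnerTianWan2024.hasIrreducibleModPGaloisRep_of_smul_eq_quadraticTwist W Wf p hd0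
      hC' hirr
  -- K★ at the optimal member of the class of `W♭`
  obtain ⟨W₀, hE₀, hM₀, hNz₀, D₀, hiso, hN, hopt₀⟩ := X12.exists_isIsogenous_optimal hnf Wf
  haveI := hE₀
  haveI := hM₀
  haveI := hNz₀
  have hadd₀ : Addv W₀ p := (X2.addv_iff_of_isIsogenous (p := p) hiso).mp haddf
  have hirr₀ : Irr W₀ p := (X12.irr_iff_of_isIsogenous hiso p).mp hirrf
  have hK₀ := forall_ne_Istar_of_isIsogenous hiso hp2 hKf
  have hv₀ : 4 < padicValInt p W₀.minimalDiscriminantInt := by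
    obtain ⟨ψ, hψ⟩ := hiso.exists_isCyclic
    have hdeg : ¬ p ∣ ψ.degree := X11b.not_dvd_degree_of_isCyclic_of_irr ψ hψ hp.out hirrf
    rw [← hDD Wf W₀ ψ p hp.out hdeg hjf]
    omega
  have hc₀ : ¬ (p : ℤ) ∣ D₀.c := hS W₀ p D₀ hp57 hadd₀ hirr₀ hK₀ hv₀ hopt₀
  -- prime-to-`p` transport back to `W♭`, at level `N(W₀) = N(W♭)`
  obtain ⟨Df, hcf⟩ :=
    ManinFrameTransport.exists_modularParametrizationData_not_dvd_of_partner Wf hp.out hirrf hiso D₀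
      hc₀
  obtain ⟨Df', hcf'⟩ := exists_datum_not_dvd_of_level_eq hN Df hcf
  -- TDS57 and the twist identity
  obtain ⟨D, hD⟩ := hT hnf p W Wf C hp57 hadd hirr hK hv4 hC
  have hc : ¬ (p : ℤ) ∣ D.c :=
    not_dvd_c_of_padicVal_modularDegree_lt' hp5 W Wf hadd hj hW6 C hC D Df' (hD Df') hcf'
  exact ⟨W, ‹_›, ‹_›, D, isIsogenous_self W, hc⟩

end Unstarred

/-! ### §5 The item, by name -/

open Summit.BirchSwinnertonDyer.BirchSwinnertonDyer.Theses.EdixhovenFibreFiveSeven in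
/-- **G57 `MemberManinUnitFiveSevenGlue` (stmt-BirchSwinnertonDyer-22229), PROVED.** Granted
modularity, Dokchitser–Dokchitser 2015 Thm. 5.1 (1), K★ and TDS57 (the item's own hypotheses), on
the `p ∈ {5, 7}` residue of route `AdditiveKolyvaginRoad` — `W/ℚ` globally minimal, `5 ≤ p < 11`,
additive at `p`, `E[p]` irreducible, residue clause (its second conjunct: some globally minimal
member without `Iₙ*` fibre at the place under `p`), every conductor-level degree in the class
divisible by `p` (unused) — some globally minimal member `W₀ ∼ W` carries a datum at level `N(W)`
with `p ∤ c(D₀)`: "no `Iₙ*`" moves to `W` (§2), then §3 (`4 < ord_p Δ_min(W)`) or §4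
(`ord_p Δ_min(W) ≤ 4`). BSD is not proved by this; K★ and TDS57 remain open cruxes.
[cite: EdixhovenManin1991, Thm. 3 and §4] [cite: DokchitserDokchitser2015LocalInvariants, Thm. 5.1 (1)]
[cite: ZagierCMB1985, §1 (p. 374)] -/
theorem memberManinUnitFiveSevenGlue_proof : MemberManinUnitFiveSevenGlue := by
  intro hnf hDD hS hT W _ _ p _ _ hp5 hp11 hadd hirr hres _hall
  -- `p ∈ {5, 7}` (the primes with `5 ≤ p < 11`; inlined, cf. the landed
  -- `WeilTypeManinGlue.eq_five_or_eq_seven_of_prime_of_five_le_of_lt_eleven`)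
  have hp57 : p = 5 ∨ p = 7 := by
    have hpp : p.Prime := Fact.out
    interval_cases p <;>
      first | exact Or.inl rfl | exact Or.inr rfl | exact absurd hpp (by decide)
  have hp2 : p ≠ 2 := by omega
  obtain ⟨-, W', hE', hM', hiso', hK'⟩ := hres
  haveI := hE'
  have hK : ∀ (v : HeightOneSpectrum ℤ) (n : ℕ), natGenerator v = p →
      W.kodairaSymbolAt v ≠ KodairaSymbol.Istar n :=
    forall_ne_Istar_of_isIsogenous hiso'.symm_of_charZero hp2 hK'
  rcases le_or_gt (padicValInt p W.minimalDiscriminantInt) 4 with h4 | h4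
  · exact exists_member_not_dvd_c_of_le_four hnf hDD hS hT W hp57 hadd hirr hK h4
  · exact exists_member_not_dvd_c_of_four_lt hnf hDD hS W hp57 hadd hirr hK h4

end Summit.BirchSwinnertonDyer.BirchSwinnertonDyer.Theorems.MemberManinUnitFiveSevenGlue

end
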